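import Summits.QuantumFields.BalabanUV.Beta.FP.PeriodisedFormIndexWard
import Summits.QuantumFields.BalabanUV.Beta.CombWilsonT2GaugeLetter

/-!
# `BalabanUV.Beta.CombWilsonT2Periodised` — binder row D1 (OWNER an2), (J-a) dictionary, item (α-3)-W: **THE SECOND-ORDER WILSON FORM SLOT AT
# LEVEL 0, TORUS SIDE — A TORUS PURE GAUGE INSERTED IN THE FIRST BACKGROUND BOND OF THE PERIODISED BI-STENCIL IS ONE HALF THE COMMUTATOR OF THE
# FIRST-ORDER WILSON MEMBER AT THE OTHER BOND WITH THE DIAGONAL GAUGE GENERATOR** — the order-2 twin of leaf-05's `FP/PeriodisedFormIndexWard`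
# (`torus_H1_pureGauge`), over the (T2-W) per-site letter `CombWilsonT2GaugeLetter.divV_wilsonT2_fst_inl_inl`

WHY.  Road «FP»'s graded (STEP) door (`FP/NestedStepLawTorusTransportedRowsGraded*`, OWNER d1-p3, rows leaf-02) displays the second-order form jet `H₂`
FREE, with the rows `k2` (the one-shot chart's `H′₂` as the gauge-conjugated word of the nested jets), `hH₂t`, `a2`.  The dictionary (JA-TABLE v1.3
ORDER-2 SLOT RULE, sharpened v1.5) binds `H₂` at the (III′) literal, level 0, to the ff block of member 0's second FIELD table `T2RecOf … 0 =
Lc⁸ • T₂ + cB • symVh₂SAn1` (`RecursiveWSlot` :75; the border table is ff-free), `T₂ := wilsonW₂ d ((8N²)⁻¹ • wsym22 N)`.  Its torus realisation needs the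
SECOND index slot summed over its period copies: the family of this file is, for a fixed LATTICE bond `β = (κ′, u′)`,
`V^{β} κ u := Σ'_n T₂ κ u κ′ (u′ + M∘n)` (a finite sum: co-plaquette pairs only), and the torus member is `perF M (dper M (V^{β} b.2 ↑b.1))∘(ff)` —
`dper` sums the JOINT translates of the pair, the `Σ'_n` the relative ones, so the wrap-around pairs of the torus are kept.  This family is covariant
under the PERIOD LATTICE of the box only (not under a blocking sublattice `N•ℤ^{d+1}`), so §1 re-runs leaf-02 g18's periodisation engine
(`PeriodisedBorderIndexWard` §1) under that weaker covariance.

CONTENT ([folklore] re-indexing of finitely supported sums over OUR typed objects BY NAME; no `def`, no `def … : Prop`, nothing cited, 0 sorry):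
* §1 `dper_apply_of_periodCov`, `sum_tgrad_mul_dper_of_indexLaw_periodCov`, **`sum_tgrad_mul_perZ_dper_of_indexLaw_periodCov`** — leaf-02's two §1
  theorems with `hM ∕ hVt` (blocking `N`, `M = N·M′`) replaced by joint invariance under the period lattice `hVt : V κ (u+M∘m) (x+M∘m) (z+M∘m) = V κ u x z`.
* §2 the second-slot-periodised Wilson bi-family `V^{β}` (hypothesis-bound: `hV : V = fun κ u x z a c => Σ'_n T₂ κ u κ′ (translate M u′ n) x z a c`):
  `summable_wilsonT2_translate` (finite support), `wilsonT2per_periodCov`, the window letters `wilsonT2per_ff_eq_zero_of_not_mem_T ∕ _S`,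
  `dper_wilsonA_ff_eq_zero_of_not_mem_S`, and the FIRST-SLOT INDEX LAW in leaf-02's `hlaw` shape **`sum_wilsonT2per_sub`**:
  `Σ_κ (V κ (w − e_κ) − V κ w) x z (ff) = ([x = w] − [z = w]) · ((−½) • dper M (wilsonA d κ′ u′)) x z (ff)` (the (T2-W) letter per copy, `tsum`med;
  `Σ'_n wilsonA κ′ (u′ + M∘n) = dper M (wilsonA κ′ u′)` by leaf-02's `dper_apply_of_blockCov` at block size 1).
* §3 torus forms, ANY box `M`, `2 ≤ N`: **`sum_tgrad_mul_perZ_dper_wilsonT2per`** (entrywise), **`torus_H2_pureGauge_fst`**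
  (`Σ_b tgrad M (b.1, inl b.2) s • H₂^{b,β} = ½ • (H₁^{β} * E_s − E_s * H₁^{β})`, `H₂^{b,β} := perF M (dper M (V^{β} b.2 ↑b.1))∘(ff)`,
  `H₁^{β} := perF M (dper M (wilsonA d κ′ u′))∘(ff)` = leaf-05's first-order member, `E_s := diagonal (tdelta M b.1 s)`), **`torus_H2_pureGauge_fst_fun`**
  (along any torus gauge function `λ`).  The second slot, the pair symmetry of the torus member, its parity and the `k2` similarity word are the sequel
  `CombWilsonT2PeriodisedK2`.
WHAT THIS IS NOT: not the border (T2-B) ∕ mixed (T2-M₂) order-2 rows (`c2 d2 q2`), not `a2`; no weight of the literal is fixed here (unit tables; the weights enter in the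
sequel's `k2` word); nothing of Bałaban's asserted; `D1Tel` ∕ `D1Rep` OPEN; NOT (T-ID), NOT (J-a) complete, NOT D1, NEVER «G-an2-4 closed», NOT BetaPertH, NOT continuum, NOT Clay.

HONEST DEPENDENCY (page 1, mandatory): continuum YM on T⁴ ⇐ BetaPertH ∧ nine spine estimates (0/9 proved); BetaPertH ⇐ (D1) ∧ (D4) ∧ CAP+tail;
G-an2-4 gates asym, D1 and NE2/3/4.  HONEST FRAMING (cell contract, verbatim): «discharging `BetaPertH` makes Bałaban's UV stability UNCONDITIONAL —
a real constructive-QFT result; it is NOT the continuum limit and NOT the Clay problem.»  ABSOLUTE RULE (cell charter, verbatim): «No internally-minted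
statement may enter as a cited fact. Every hypothesis is either kernel-proved in this package or a verbatim quotation of a PUBLISHED theorem with page
reference. The manuscript(s) under audit are NOT citable for their own disputed steps — they are the thing under adjudication; programme-internal
(2001/route/tribunal) claims are never citable.»  Row D1 OWNER an2 (b2b-balaban-beta-an2) gen 42, 2026-08-22.  §1 adapted from leaf-02 g18's
`FP/PeriodisedBorderIndexWard` §1 (same proof, weaker covariance); §3 shaped on leaf-05 g27's `FP/PeriodisedFormIndexWard` §3.  No existing file touched.
-/

noncomputable section

open scoped BigOperators

namespace Summit.QuantumFields.BalabanUV.Beta.CombWilsonT2Periodised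

open Finset Matrix
open Literature.MathematicalPhysics.QuantumFieldTheory.Balaban1983to89
open Literature.MathematicalPhysics.QuantumFieldTheory.Balaban1983to89.Beta
open B12Sec2to5 (l1 l1_nonneg)
open B4TorusKernel.MultiPeriod (translate translate_apply)
open B4Reflection242 (translate_translate)
open B6Lemma24Torus (pbox mem_pbox)
open ExpKernelCalculus (MKer shiftK l1_sub_triangle l1_sub_symm)
open StepJetData (wilsonA wilsonA_translate)
open WilsonBiStencil (wilsonW₂ wEntry₂ wilsonW₂_inl_inl wEntry₂_eq_zero_or wilsonW₂_translate)
open WilsonVertex2Sym (wsym22)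
open AffineAveraging (Site unitVec dz)
open OneStepResolventKernel (Fib)
open Summit.QuantumFields.BalabanUV.Beta.AxialDressingRooted (cube mem_cube)
open Summit.QuantumFields.BalabanUV.Beta.WardLocusStencils (divV_apply)
open Summit.QuantumFields.BalabanUV.Beta.GAN24.ContactOneGaugeCellAlgebra (affine_unitVec_eq)
open Summit.QuantumFields.BalabanUV.Beta.GAN24.Push3GaugeSlotCells (mem_cube_of_l1_le wilsonA_ff_eq_zero_of_not_mem_left)
open Summit.QuantumFields.BalabanUV.Beta.GAN24.BorderGaugeLegContact (tsum_mul_ite_sub_ite_mul tsum_sum_dz_mul_eq)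
open Summit.QuantumFields.BalabanUV.Beta.CombWilsonT2GaugeLetter (divV_wilsonT2_fst_inl_inl)
open Summit.QuantumFields.BalabanUV.Beta.FP.KernelPeriodisationFib (Idx perF perF_apply perZ perZ_apply perZ_smul translate_eq_add)
open Summit.QuantumFields.BalabanUV.Beta.FP.KernelPeriodisationFibLoc (dper dper_apply)
open Summit.QuantumFields.BalabanUV.Beta.FP.KernelPeriodisationFibTrace (tsum_sites_eq_sum_tsum)
open Summit.QuantumFields.BalabanUV.Beta.FP.TorusGaugeCovariance (tdelta tdelta_translate tgrad tgrad_inl)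
open Summit.QuantumFields.BalabanUV.Beta.FP.TorusGaugeCovariancePairing (sum_tdelta_mul wrapPt_of_mem)
open Summit.QuantumFields.BalabanUV.Beta.FP.PeriodisedBorderTables (dper_apply_of_blockCov)
open Summit.QuantumFields.BalabanUV.Beta.FP.PeriodisedBorderIndexWard (translate_injective)

variable {d : ℕ}

/-! ## §1 leaf-02's periodisation engine under covariance by the PERIOD LATTICE only -/

section Generic

variable {M : Fin (d + 1) → ℕ} [∀ μ, NeZero (M μ)]
  (V : Fin (d + 1) → Site (d + 1) → MKer (d + 1) (Fib d)) (q : MKer (d + 1) (Fib d)) (p₁ : Site (d + 1) → Site (d + 1))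
  (S T : Site (d + 1) → Finset (Site (d + 1))) (a b : Fib d)

omit [∀ μ, NeZero (M μ)] in
/-- [folklore] **THE TORUS INSERTION IS THE SUM OVER THE COPIES OF THE BOND** for a family JOINTLY INVARIANT under the period lattice of the box
(`hVt`): `dper M (V κ u) x z a b = Σ'_m V κ (u + M∘m) x z a b` (re-indexing `m ↦ −m`; no convergence needed) — leaf-02's `dper_apply_of_blockCov` with
the blocking hypothesis `M = N·M′` dropped. -/
theorem dper_apply_of_periodCov
    (hVt : ∀ (κ : Fin (d + 1)) (u m x z : Site (d + 1)) (a b : Fib d),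
      V κ (translate M u m) (translate M x m) (translate M z m) a b = V κ u x z a b)
    (κ : Fin (d + 1)) (u x z : Site (d + 1)) (a b : Fib d) :
    dper M (V κ u) x z a b = ∑' m : Site (d + 1), V κ (translate M u m) x z a b := by
  rw [dper_apply, ← (Equiv.neg (Site (d + 1))).tsum_eq fun m => V κ (translate M u m) x z a b]
  refine tsum_congr fun m => ?_
  have h0 : translate M (translate M u (-m)) m = u := by
    rw [translate_translate, neg_add_cancel]
    funext i
    rw [translate_apply, Pi.zero_apply, mul_zero, add_zero]
  have h := hVt κ (translate M u (-m)) m x z a b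
  rw [h0] at h
  exact h

/-- [folklore] **THE TORUS INSERTION (family index on the box, copies summed by `dper`) OF A TORUS PURE GAUGE, at one lattice fluctuation site** — leaf-02's
`sum_tgrad_mul_dper_of_indexLaw` under period-lattice covariance: finite family support (`hT`) and the index-slot law `hlaw` ⟹
`Σ_{u ∈ pbox M} Σ_κ tgrad M (u, inl κ) s · dper M (V κ u) x z a b = (tdelta M (p₁ x) s − tdelta M z s) · q x z a b`. -/
theorem sum_tgrad_mul_dper_of_indexLaw_periodCov
    (hVt : ∀ (κ : Fin (d + 1)) (u m x z : Site (d + 1)) (a b : Fib d),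
      V κ (translate M u m) (translate M x m) (translate M z m) a b = V κ u x z a b)
    (hT : ∀ (κ : Fin (d + 1)) (x z : Site (d + 1)), ∀ u ∉ T x, V κ u x z a b = 0)
    (hlaw : ∀ (w x z : Site (d + 1)), ∑ κ, (V κ (w - unitVec κ) x z a b - V κ w x z a b)
      = ((if p₁ x = w then (1 : ℝ) else 0) - (if z = w then 1 else 0)) * q x z a b)
    (s : ↥(pbox M)) (x z : Site (d + 1)) :
    ∑ u : ↥(pbox M), ∑ κ : Fin (d + 1), tgrad M (u, Sum.inl κ) s * dper M (V κ (u : Site (d + 1))) x z a b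
      = (tdelta M (p₁ x) s - tdelta M z s) * q x z a b := by
  set H : Site (d + 1) → ℝ := fun u => ∑ κ, dz (fun w => tdelta M w s) κ u * V κ u x z a b with hH
  have hHs : Summable H :=
    summable_of_ne_finset_zero (s := T x) fun u hu => Finset.sum_eq_zero fun κ _ => by rw [hT κ x z u hu, mul_zero]
  have hterm : ∀ (u : ↥(pbox M)) (κ : Fin (d + 1)),
      tgrad M (u, Sum.inl κ) s * dper M (V κ (u : Site (d + 1))) x z a b
        = ∑' m : Site (d + 1), dz (fun w => tdelta M w s) κ (translate M (u : Site (d + 1)) m) * V κ (translate M (u : Site (d + 1)) m) x z a b := fun u κ => by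
    rw [dper_apply_of_periodCov V hVt κ (u : Site (d + 1)) x z a b, ← tsum_mul_left]
    refine tsum_congr fun m => ?_
    congr 1
    simp only [tgrad_inl, dz]
    rw [show translate M (u : Site (d + 1)) m + unitVec κ = translate M ((u : Site (d + 1)) + unitVec κ) m by
        funext i; simp only [B4TorusKernel.MultiPeriod.translate_apply, Pi.add_apply]; ring, tdelta_translate, tdelta_translate]
  have hswap : ∀ u : ↥(pbox M), ∑ κ : Fin (d + 1), tgrad M (u, Sum.inl κ) s * dper M (V κ (u : Site (d + 1))) x z a b
      = ∑' m : Site (d + 1), H (translate M (u : Site (d + 1)) m) := fun u => by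
    rw [Finset.sum_congr rfl fun κ _ => hterm u κ, ← Summable.tsum_finsetSum]
    intro κ _
    exact summable_of_ne_finset_zero (s := (T x).preimage _ (translate_injective (M := M) (u : Site (d + 1))).injOn) fun m hm => by
      rw [hT κ x z _ (fun h => hm (Finset.mem_preimage.2 h)), mul_zero]
  rw [Finset.sum_congr rfl fun u _ => hswap u, ← tsum_sites_eq_sum_tsum M hHs, hH]
  rw [tsum_sum_dz_mul_eq (fun κ u => V κ u x z a b)
    (fun κ g => summable_of_ne_finset_zero (s := T x) fun u hu => by rw [hT κ x z u hu, mul_zero]) (fun w => tdelta M w s)]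
  simp only [hlaw]
  exact tsum_mul_ite_sub_ite_mul (fun w => tdelta M w s) (p₁ x) z (q x z a b)

/-- [folklore] **… AND PERIODISED IN THE FLUCTUATION SLOT** — leaf-02's `sum_tgrad_mul_perZ_dper_of_indexLaw` under period-lattice covariance (`hS`: finite
fluctuation-slot support uniform in the family index; `hqS` the same for `q`; `p₁` a lattice function of `x`): for every torus gauge parameter `s`,
`Σ_{u ∈ pbox M} Σ_κ tgrad M (u, inl κ) s · perZ M (dper M (V κ u)) x z a b = (tdelta M (p₁ x) s − tdelta M z s) · perZ M q x z a b`. -/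
theorem sum_tgrad_mul_perZ_dper_of_indexLaw_periodCov
    (hVt : ∀ (κ : Fin (d + 1)) (u m x z : Site (d + 1)) (a b : Fib d),
      V κ (translate M u m) (translate M x m) (translate M z m) a b = V κ u x z a b)
    (hS : ∀ (κ : Fin (d + 1)) (u x : Site (d + 1)), ∀ z ∉ S x, V κ u x z a b = 0)
    (hT : ∀ (κ : Fin (d + 1)) (x z : Site (d + 1)), ∀ u ∉ T x, V κ u x z a b = 0)
    (hqS : ∀ x : Site (d + 1), ∀ z ∉ S x, q x z a b = 0)
    (hlaw : ∀ (w x z : Site (d + 1)), ∑ κ, (V κ (w - unitVec κ) x z a b - V κ w x z a b)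
      = ((if p₁ x = w then (1 : ℝ) else 0) - (if z = w then 1 else 0)) * q x z a b)
    (s : ↥(pbox M)) (x z : Site (d + 1)) :
    ∑ u : ↥(pbox M), ∑ κ : Fin (d + 1), tgrad M (u, Sum.inl κ) s * perZ M (dper M (V κ (u : Site (d + 1)))) x z a b
      = (tdelta M (p₁ x) s - tdelta M z s) * perZ M q x z a b := by
  have hdS : ∀ (κ : Fin (d + 1)) (u : Site (d + 1)), ∀ z' ∉ S x, dper M (V κ u) x z' a b = 0 := fun κ u z' hz' => by
    rw [dper_apply_of_periodCov V hVt κ u x z' a b]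
    exact (tsum_congr fun m => hS κ _ x z' hz').trans tsum_zero
  set F : Finset (Site (d + 1)) := (S x).preimage (fun m => translate M z m) (translate_injective (M := M) z).injOn with hF
  have hF' : ∀ m ∉ F, translate M z m ∉ S x := fun m hm hz => hm (Finset.mem_preimage.2 hz)
  have hper : ∀ (u : ↥(pbox M)) (κ : Fin (d + 1)),
      perZ M (dper M (V κ (u : Site (d + 1)))) x z a b = ∑ m ∈ F, dper M (V κ (u : Site (d + 1))) x (translate M z m) a b := fun u κ => by
    rw [perZ_apply]
    exact tsum_eq_sum fun m hm => hdS κ _ _ (hF' m hm)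
  simp only [hper, Finset.mul_sum]
  have h1 : ∀ u : ↥(pbox M), ∑ κ : Fin (d + 1), ∑ m ∈ F, tgrad M (u, Sum.inl κ) s * dper M (V κ (u : Site (d + 1))) x (translate M z m) a b
      = ∑ m ∈ F, ∑ κ : Fin (d + 1), tgrad M (u, Sum.inl κ) s * dper M (V κ (u : Site (d + 1))) x (translate M z m) a b := fun u => Finset.sum_comm
  rw [Finset.sum_congr rfl fun u _ => h1 u, Finset.sum_comm]
  have h2 : ∀ m : Site (d + 1), ∑ u : ↥(pbox M), ∑ κ : Fin (d + 1), tgrad M (u, Sum.inl κ) s * dper M (V κ (u : Site (d + 1))) x (translate M z m) a b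
      = (tdelta M (p₁ x) s - tdelta M z s) * q x (translate M z m) a b := fun m => by
    rw [sum_tgrad_mul_dper_of_indexLaw_periodCov V q p₁ T a b hVt hT hlaw s x (translate M z m), tdelta_translate]
  rw [Finset.sum_congr rfl fun m _ => h2 m, ← Finset.mul_sum, perZ_apply, tsum_eq_sum fun m hm => hqS x _ (hF' m hm)]

end Generic

/-! ## §2 The Wilson bi-stencil with its SECOND background bond summed over the period copies: covariance, window letters, the first-slot law -/

section Family

variable {N : ℕ} (M : Fin (d + 1) → ℕ) [∀ μ, NeZero (M μ)] (κ' : Fin (d + 1)) (u' : Site (d + 1))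

/-- [folklore] the copies of the second bond meeting a given column site are finitely many: `n ↦ T₂ κ u κ′ (u′ + M∘n) x z a c` is summable
(co-plaquette support `WilsonBiStencil.wEntry₂_eq_zero_or`: a nonzero ff entry forces `|z − (u′ + M∘n)|₁ ≤ 2`; the other blocks vanish). -/
theorem summable_wilsonT2_translate (T : Fin 4 → Fin 4 → Fin 4 → Fin 4 → ℝ) (κ : Fin (d + 1)) (u x z : Site (d + 1)) (a c : Fib d) :
    Summable fun n : Site (d + 1) => wilsonW₂ d T κ u κ' (translate M u' n) x z a c := by
  rcases a with α | α <;> rcases c with γ | γ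
  · refine summable_of_ne_finset_zero
      (s := ((cube (d + 1) 2).image (fun v => z - v)).preimage (fun n => translate M u' n) (translate_injective (M := M) u').injOn) fun n hn => ?_
    rw [wilsonW₂_inl_inl]
    rcases wEntry₂_eq_zero_or T κ u κ' (translate M u' n) x z α γ with h0 | ⟨-, hz, -⟩
    · exact h0
    · exact absurd (Finset.mem_preimage.2 (Finset.mem_image.2 ⟨z - translate M u' n, mem_cube_of_l1_le hz, sub_sub_cancel _ _⟩)) hn
  · exact summable_zero
  · exact summable_zero
  · exact summable_zero

omit [∀ μ, NeZero (M μ)] in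
/-- [folklore] a copy of the second bond, shifted back by a period vector, is another copy:
`translate M u′ n = translate M u′ (n − m) + M∘m`. -/
theorem translate_eq_translate_sub_add (n m : Site (d + 1)) :
    translate M u' n = translate M u' (n - m) + fun i => (M i : ℤ) * m i := by
  rw [translate_eq_add, translate_eq_add]
  funext i
  simp only [Pi.add_apply, Pi.sub_apply]
  ring

variable {M κ' u'}
variable (T : Fin 4 → Fin 4 → Fin 4 → Fin 4 → ℝ) {V : Fin (d + 1) → Site (d + 1) → MKer (d + 1) (Fib d)}

omit [∀ μ, NeZero (M μ)] in
/-- [folklore] **JOINT INVARIANCE UNDER THE PERIOD LATTICE** of the second-slot-periodised bi-family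
`V κ u := Σ'_n T₂ κ u κ′ (u′ + M∘n)`: `V κ (u + M∘m) (x + M∘m) (z + M∘m) = V κ u x z` (an3's `wilsonW₂_translate` per copy, re-indexing `n ↦ n − m`). -/
theorem wilsonT2per_periodCov
    (hV : V = fun κ u x z a c => ∑' n : Site (d + 1), wilsonW₂ d T κ u κ' (translate M u' n) x z a c)
    (κ : Fin (d + 1)) (u m x z : Site (d + 1)) (a c : Fib d) :
    V κ (translate M u m) (translate M x m) (translate M z m) a c = V κ u x z a c := by
  subst hV
  show (∑' n : Site (d + 1), wilsonW₂ d T κ (translate M u m) κ' (translate M u' n) (translate M x m) (translate M z m) a c)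
      = ∑' n : Site (d + 1), wilsonW₂ d T κ u κ' (translate M u' n) x z a c
  rw [← (Equiv.subRight m).tsum_eq fun n => wilsonW₂ d T κ u κ' (translate M u' n) x z a c]
  refine tsum_congr fun n => ?_
  rw [Equiv.subRight_apply, translate_eq_add M u m, translate_eq_add M x m, translate_eq_add M z m,
    translate_eq_translate_sub_add M u' n m, wilsonW₂_translate]
  simp only [shiftK, add_neg_cancel_right]

omit [∀ μ, NeZero (M μ)] in
/-- [folklore] window letter `hT` (family index): the ff entry of `V κ u` at `(x, z)` vanishes unless `u ∈ x − cube 2`. -/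
theorem wilsonT2per_ff_eq_zero_of_not_mem_T
    (hV : V = fun κ u x z a c => ∑' n : Site (d + 1), wilsonW₂ d T κ u κ' (translate M u' n) x z a c)
    (κ : Fin (d + 1)) (x z : Site (d + 1)) (α γ : Fin (d + 1)) :
    ∀ u ∉ (cube (d + 1) 2).image (fun v => x - v), V κ u x z (Sum.inl α) (Sum.inl γ) = 0 := fun u hu => by
  subst hV
  refine (tsum_congr fun n => ?_).trans tsum_zero
  rw [wilsonW₂_inl_inl]
  rcases wEntry₂_eq_zero_or T κ u κ' (translate M u' n) x z α γ with h0 | ⟨hx, -, -⟩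
  · exact h0
  · exact absurd (Finset.mem_image.2 ⟨x - u, mem_cube_of_l1_le hx, sub_sub_cancel x u⟩) hu

omit [∀ μ, NeZero (M μ)] in
/-- [folklore] window letter `hS` (column site): the ff entry of `V κ u` at `(x, z)` vanishes unless `z ∈ x − cube 6`
(`|x − z|₁ ≤ |x − u|₁ + |u − (u′+M∘n)|₁ + |(u′+M∘n) − z|₁ ≤ 6` on the support). -/
theorem wilsonT2per_ff_eq_zero_of_not_mem_S
    (hV : V = fun κ u x z a c => ∑' n : Site (d + 1), wilsonW₂ d T κ u κ' (translate M u' n) x z a c)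
    (κ : Fin (d + 1)) (u x : Site (d + 1)) (α γ : Fin (d + 1)) :
    ∀ z ∉ (cube (d + 1) 6).image (fun v => x - v), V κ u x z (Sum.inl α) (Sum.inl γ) = 0 := fun z hz => by
  subst hV
  refine (tsum_congr fun n => ?_).trans tsum_zero
  rw [wilsonW₂_inl_inl]
  rcases wEntry₂_eq_zero_or T κ u κ' (translate M u' n) x z α γ with h0 | ⟨hx, hzw, hwu⟩
  · exact h0
  · exfalso
    refine hz (Finset.mem_image.2 ⟨x - z, mem_cube_of_l1_le ?_, sub_sub_cancel x z⟩)
    have h1 : l1 (x - z) ≤ l1 (x - u) + l1 (u - z) := l1_sub_triangle x u z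
    have h2 : l1 (u - z) ≤ l1 (u - translate M u' n) + l1 (translate M u' n - z) := l1_sub_triangle u (translate M u' n) z
    have h3 : l1 (u - translate M u' n) = l1 (translate M u' n - u) := l1_sub_symm u (translate M u' n)
    have h4 : l1 (translate M u' n - z) = l1 (z - translate M u' n) := l1_sub_symm (translate M u' n) z
    have h5 : l1 (x - z) ≤ 6 := by linarith
    exact_mod_cast h5

omit [∀ μ, NeZero (M μ)] in
/-- [folklore] window letter `hqS` for the contact kernel: the ff entry of `c • dper M (wilsonA d κ′ u′)` at `(x, z)` vanishes unless `z ∈ x − cube 6`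
(every copy has `x − z ∈ cube 4`, gan24's `wilsonA_ff_eq_zero_of_not_mem_left`). -/
theorem dper_wilsonA_ff_eq_zero_of_not_mem_S (c : ℝ) (x : Site (d + 1)) (α γ : Fin (d + 1)) :
    ∀ z ∉ (cube (d + 1) 6).image (fun v => x - v), (c • dper M (wilsonA d κ' u')) x z (Sum.inl α) (Sum.inl γ) = 0 := fun z hz => by
  rw [Pi.smul_apply, Pi.smul_apply, Pi.smul_apply, Pi.smul_apply, smul_eq_mul, dper_apply]
  have hxz : x - z ∉ cube (d + 1) 4 := fun h => hz (Finset.mem_image.2 ⟨x - z, mem_cube.2 fun i => by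
    have hi := (mem_cube.1 h) i
    push_cast at hi ⊢
    linarith, sub_sub_cancel x z⟩)
  rw [(tsum_congr fun m => ?_).trans tsum_zero, mul_zero]
  refine wilsonA_ff_eq_zero_of_not_mem_left fun h => hxz ?_
  rwa [translate_eq_add, translate_eq_add, add_sub_add_right_eq_sub] at h

/-- [folklore] **`sum_wilsonT2per_sub` — THE FIRST-SLOT INDEX LAW OF THE SECOND-SLOT-PERIODISED WILSON BI-FAMILY** (`2 ≤ N`, `T := (8N²)⁻¹ • wsym22 N`),
in leaf-02's `hlaw` Σ-shape on the ff block: `Σ_κ (V κ (w − e_κ) − V κ w) x z (inl α) (inl γ) = ([x = w] − [z = w]) · ((−½) • dper M (wilsonA d κ′ u′)) x z (inl α) (inl γ)`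
— the (T2-W) letter `divV_wilsonT2_fst_inl_inl` for each copy `u′ + M∘n` of the second bond, summed; `Σ'_n wilsonA κ′ (u′ + M∘n) = dper M (wilsonA κ′ u′)`
(leaf-02's `dper_apply_of_blockCov` at block size `1`: the first-order Wilson table is fine-translation covariant). -/
theorem sum_wilsonT2per_sub (hN : 2 ≤ N)
    (hV : V = fun κ u x z a c => ∑' n : Site (d + 1), wilsonW₂ d ((8 * (N : ℝ) ^ 2)⁻¹ • wsym22 N) κ u κ' (translate M u' n) x z a c)
    (w x z : Site (d + 1)) (α γ : Fin (d + 1)) :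
    ∑ κ : Fin (d + 1), (V κ (w - unitVec κ) x z (Sum.inl α) (Sum.inl γ) - V κ w x z (Sum.inl α) (Sum.inl γ))
      = ((if x = w then (1 : ℝ) else 0) - (if z = w then 1 else 0))
          * ((-(1 / 2 : ℝ)) • dper M (wilsonA d κ' u')) x z (Sum.inl α) (Sum.inl γ) := by
  subst hV
  set T₂ := wilsonW₂ d ((8 * (N : ℝ) ^ 2)⁻¹ • wsym22 N) with hT₂
  -- termwise difference of two convergent copies-sums, then the finite `κ`-sum inside the `n`-sum
  have hsum : ∀ κ : Fin (d + 1),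
      (∑' n : Site (d + 1), T₂ κ (w - unitVec κ) κ' (translate M u' n) x z (Sum.inl α) (Sum.inl γ))
        - (∑' n : Site (d + 1), T₂ κ w κ' (translate M u' n) x z (Sum.inl α) (Sum.inl γ))
      = ∑' n : Site (d + 1), (T₂ κ (w - unitVec κ) κ' (translate M u' n) x z (Sum.inl α) (Sum.inl γ)
          - T₂ κ w κ' (translate M u' n) x z (Sum.inl α) (Sum.inl γ)) := fun κ =>
    ((summable_wilsonT2_translate M κ' u' _ κ (w - unitVec κ) x z _ _).tsum_sub (summable_wilsonT2_translate M κ' u' _ κ w x z _ _)).symm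
  simp only [hsum]
  rw [← Summable.tsum_finsetSum (fun κ _ => (summable_wilsonT2_translate M κ' u' _ κ (w - unitVec κ) x z _ _).sub
    (summable_wilsonT2_translate M κ' u' _ κ w x z _ _))]
  -- the (T2-W) letter, copy by copy
  have hcopy : ∀ n : Site (d + 1), ∑ κ : Fin (d + 1), (T₂ κ (w - unitVec κ) κ' (translate M u' n) x z (Sum.inl α) (Sum.inl γ)
        - T₂ κ w κ' (translate M u' n) x z (Sum.inl α) (Sum.inl γ))
      = ((if x = w then (1 : ℝ) else 0) - (if z = w then 1 else 0))
          * ((-(1 / 2 : ℝ)) * wilsonA d κ' (translate M u' n) x z (Sum.inl α) (Sum.inl γ)) := fun n => by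
    have hdiv : ∑ κ : Fin (d + 1), (T₂ κ (w - unitVec κ) κ' (translate M u' n) x z (Sum.inl α) (Sum.inl γ)
          - T₂ κ w κ' (translate M u' n) x z (Sum.inl α) (Sum.inl γ))
        = KernelWard.divV (fun κ u => T₂ κ u κ' (translate M u' n)) w x z (Sum.inl α) (Sum.inl γ) := by
      rw [divV_apply]
      exact Finset.sum_congr rfl fun κ _ => by rw [affine_unitVec_eq]
    rw [hdiv, hT₂, divV_wilsonT2_fst_inl_inl hN κ' (translate M u' n) w x z α γ]
    ring
  rw [tsum_congr hcopy, tsum_mul_left, tsum_mul_left, Pi.smul_apply, Pi.smul_apply, Pi.smul_apply, Pi.smul_apply, smul_eq_mul,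
    dper_apply_of_blockCov (N := 1) (M' := M) (V := wilsonA d) (fun i => (one_mul (M i)).symm) (fun κ u t => wilsonA_translate κ u _) κ' u' x z
      (Sum.inl α) (Sum.inl γ)]

end Family

/-! ## §3 Torus forms: the second-order Wilson family with a torus pure gauge in its FIRST bond (any box `M`, `2 ≤ N`) -/

section Torus

variable {N : ℕ} (M : Fin (d + 1) → ℕ) [∀ μ, NeZero (M μ)] (κ' : Fin (d + 1)) (u' : Site (d + 1))
  {V : Fin (d + 1) → Site (d + 1) → MKer (d + 1) (Fib d)}

/-- [folklore] **ENTRYWISE**: `Σ_{u ∈ pbox M} Σ_κ tgrad M (u, inl κ) s · perZ M (dper M (V κ u)) x z (inl α) (inl γ)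
= (tdelta M x s − tdelta M z s) · perZ M ((−½) • dper M (wilsonA d κ′ u′)) x z (inl α) (inl γ)` — §1's engine fed §2's letters. -/
theorem sum_tgrad_mul_perZ_dper_wilsonT2per (hN : 2 ≤ N)
    (hV : V = fun κ u x z a c => ∑' n : Site (d + 1), wilsonW₂ d ((8 * (N : ℝ) ^ 2)⁻¹ • wsym22 N) κ u κ' (translate M u' n) x z a c)
    (s : ↥(pbox M)) (x z : Site (d + 1)) (α γ : Fin (d + 1)) :
    ∑ u : ↥(pbox M), ∑ κ : Fin (d + 1), tgrad M (u, Sum.inl κ) s * perZ M (dper M (V κ (u : Site (d + 1)))) x z (Sum.inl α) (Sum.inl γ)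
      = (tdelta M x s - tdelta M z s) * perZ M ((-(1 / 2 : ℝ)) • dper M (wilsonA d κ' u')) x z (Sum.inl α) (Sum.inl γ) :=
  sum_tgrad_mul_perZ_dper_of_indexLaw_periodCov (M := M) V ((-(1 / 2 : ℝ)) • dper M (wilsonA d κ' u')) (fun x => x)
    (fun x => (cube (d + 1) 6).image (fun v => x - v)) (fun x => (cube (d + 1) 2).image (fun v => x - v)) (Sum.inl α) (Sum.inl γ)
    (wilsonT2per_periodCov _ hV) (fun κ u x => wilsonT2per_ff_eq_zero_of_not_mem_S _ hV κ u x α γ)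
    (fun κ x z => wilsonT2per_ff_eq_zero_of_not_mem_T _ hV κ x z α γ) (fun x => dper_wilsonA_ff_eq_zero_of_not_mem_S _ x α γ)
    (fun w x z => sum_wilsonT2per_sub hN hV w x z α γ) s x z

/-- [folklore] **`torus_H2_pureGauge_fst` — MATRIX FORM ON ANY BOX**: with the torus bi-member `H₂^{b,β} := perF M (dper M (V b.2 ↑b.1))∘(ff)` (first bond `b` on the
torus, second bond `β = (κ′, u′)` a lattice bond, its period copies summed inside `V`) and leaf-05's first-order member `H₁^{β} := perF M (dper M (wilsonA d κ′ u′))∘(ff)`,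
for every torus gauge parameter `s`: `Σ_b tgrad M (b.1, inl b.2) s • H₂^{b,β} = ½ • (H₁^{β} * E_s − E_s * H₁^{β})`, `E_s := diagonal (tdelta M b.1 s)`. -/
theorem torus_H2_pureGauge_fst (hN : 2 ≤ N)
    (hV : V = fun κ u x z a c => ∑' n : Site (d + 1), wilsonW₂ d ((8 * (N : ℝ) ^ 2)⁻¹ • wsym22 N) κ u κ' (translate M u' n) x z a c)
    (s : ↥(pbox M)) :
    (∑ b : ↥(pbox M) × Fin (d + 1), tgrad M (b.1, Sum.inl b.2) s •
        (perF M (dper M (V b.2 (b.1 : Site (d + 1))))).submatrix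
          (fun b : ↥(pbox M) × Fin (d + 1) => ((b.1, Sum.inl b.2) : Idx M (Fib d)))
          (fun b : ↥(pbox M) × Fin (d + 1) => ((b.1, Sum.inl b.2) : Idx M (Fib d))))
      = (1 / 2 : ℝ) • ((perF M (dper M (wilsonA d κ' u'))).submatrix
            (fun b : ↥(pbox M) × Fin (d + 1) => ((b.1, Sum.inl b.2) : Idx M (Fib d)))
            (fun b : ↥(pbox M) × Fin (d + 1) => ((b.1, Sum.inl b.2) : Idx M (Fib d)))
          * Matrix.diagonal (fun b : ↥(pbox M) × Fin (d + 1) => tdelta M (b.1 : Site (d + 1)) s)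
        - Matrix.diagonal (fun b : ↥(pbox M) × Fin (d + 1) => tdelta M (b.1 : Site (d + 1)) s)
          * (perF M (dper M (wilsonA d κ' u'))).submatrix
            (fun b : ↥(pbox M) × Fin (d + 1) => ((b.1, Sum.inl b.2) : Idx M (Fib d)))
            (fun b : ↥(pbox M) × Fin (d + 1) => ((b.1, Sum.inl b.2) : Idx M (Fib d)))) := by
  ext x z
  rw [Matrix.sum_apply, Matrix.smul_apply, Matrix.sub_apply, Matrix.diagonal_mul, Matrix.mul_diagonal, smul_eq_mul]
  simp only [Matrix.smul_apply, Matrix.submatrix_apply, perF_apply, smul_eq_mul]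
  rw [Fintype.sum_prod_type, sum_tgrad_mul_perZ_dper_wilsonT2per M κ' u' hN hV s _ _ x.2 z.2, perZ_smul]
  simp only [Pi.smul_apply, smul_eq_mul]
  ring

/-- [folklore] **ALONG ANY TORUS GAUGE FUNCTION** `λ : ↥(pbox M) → ℝ` (`(Dλ)_b := Σ_s tgrad M (b.1, inl b.2) s · λ s`):
`Σ_b (Dλ)_b • H₂^{b,β} = ½ • (H₁^{β} * E_λ − E_λ * H₁^{β})`, `E_λ := diagonal (fun b => λ b.1)`. -/
theorem torus_H2_pureGauge_fst_fun (hN : 2 ≤ N)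
    (hV : V = fun κ u x z a c => ∑' n : Site (d + 1), wilsonW₂ d ((8 * (N : ℝ) ^ 2)⁻¹ • wsym22 N) κ u κ' (translate M u' n) x z a c)
    (lam : ↥(pbox M) → ℝ) :
    (∑ b : ↥(pbox M) × Fin (d + 1), (∑ s : ↥(pbox M), tgrad M (b.1, Sum.inl b.2) s * lam s) •
        (perF M (dper M (V b.2 (b.1 : Site (d + 1))))).submatrix
          (fun b : ↥(pbox M) × Fin (d + 1) => ((b.1, Sum.inl b.2) : Idx M (Fib d)))
          (fun b : ↥(pbox M) × Fin (d + 1) => ((b.1, Sum.inl b.2) : Idx M (Fib d))))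
      = (1 / 2 : ℝ) • ((perF M (dper M (wilsonA d κ' u'))).submatrix
            (fun b : ↥(pbox M) × Fin (d + 1) => ((b.1, Sum.inl b.2) : Idx M (Fib d)))
            (fun b : ↥(pbox M) × Fin (d + 1) => ((b.1, Sum.inl b.2) : Idx M (Fib d)))
          * Matrix.diagonal (fun b : ↥(pbox M) × Fin (d + 1) => lam b.1)
        - Matrix.diagonal (fun b : ↥(pbox M) × Fin (d + 1) => lam b.1)
          * (perF M (dper M (wilsonA d κ' u'))).submatrix
            (fun b : ↥(pbox M) × Fin (d + 1) => ((b.1, Sum.inl b.2) : Idx M (Fib d)))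
            (fun b : ↥(pbox M) × Fin (d + 1) => ((b.1, Sum.inl b.2) : Idx M (Fib d)))) := by
  have hswap : (∑ b : ↥(pbox M) × Fin (d + 1), (∑ s : ↥(pbox M), tgrad M (b.1, Sum.inl b.2) s * lam s) •
        (perF M (dper M (V b.2 (b.1 : Site (d + 1))))).submatrix
          (fun b : ↥(pbox M) × Fin (d + 1) => ((b.1, Sum.inl b.2) : Idx M (Fib d)))
          (fun b : ↥(pbox M) × Fin (d + 1) => ((b.1, Sum.inl b.2) : Idx M (Fib d))))
      = ∑ s : ↥(pbox M), lam s • ∑ b : ↥(pbox M) × Fin (d + 1), tgrad M (b.1, Sum.inl b.2) s •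
        (perF M (dper M (V b.2 (b.1 : Site (d + 1))))).submatrix
          (fun b : ↥(pbox M) × Fin (d + 1) => ((b.1, Sum.inl b.2) : Idx M (Fib d)))
          (fun b : ↥(pbox M) × Fin (d + 1) => ((b.1, Sum.inl b.2) : Idx M (Fib d))) := by
    simp only [Finset.sum_smul, Finset.smul_sum, smul_smul, mul_comm (lam _)]
    exact Finset.sum_comm
  rw [hswap, Finset.sum_congr rfl fun s _ => by rw [torus_H2_pureGauge_fst M κ' u' hN hV s]]
  ext x z
  simp only [Matrix.sum_apply, Matrix.smul_apply, Matrix.sub_apply, Matrix.diagonal_mul, Matrix.mul_diagonal, smul_eq_mul]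
  rw [show lam z.1 = ∑ s : ↥(pbox M), tdelta M ((z.1 : ↥(pbox M)) : Site (d + 1)) s * lam s by rw [sum_tdelta_mul, wrapPt_of_mem],
    show lam x.1 = ∑ s : ↥(pbox M), tdelta M ((x.1 : ↥(pbox M)) : Site (d + 1)) s * lam s by rw [sum_tdelta_mul, wrapPt_of_mem]]
  simp only [Finset.mul_sum, Finset.sum_mul, mul_sub, Finset.sum_sub_distrib]
  congr 1 <;> exact Finset.sum_congr rfl fun s _ => by ring

end Torus

end Summit.QuantumFields.BalabanUV.Beta.CombWilsonT2Periodised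

end
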